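import Mathlib
import Summits.ResolutionOfSingularities.ResolutionOfSingularities.Theorems.RadicialJungCleanModelsL1AdjoinRoot
import Literature.AlgebraicGeometry.Resolution.LocalBlowup
import Summits.ResolutionOfSingularities.ResolutionOfSingularities.Theorems.ValuativeLuAlphaPTorsorTowerModel
import Literature.AlgebraicGeometry.Resolution.ExcellentRings
import Literature.AlgebraicGeometry.Resolution.ExcellentRingsEssFiniteType
import Literature.AlgebraicGeometry.Resolution.ExcellentRingsFieldProofs
import HarnessLib

/-!
# Crux stmt-ResolutionOfSingularities-15917 (`RadicialJung.CleanModels`), skeleton `Sketch` rev 12, stub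
# `stub_cleanLU3_of_frame`: the DIMENSION-3 CENTRE case — Cossart–Piltant's (S,h,E)-frame gives clean local
# uniformization at a valuation whose centre on the regular affine model has a 3-dimensional local ring

Line card `Cruxes/CleanModels/Lines/Sketch-P2-plan.md` (lead `res-B-lead-1` g0, 2026-08-28).  The registered stub
`stub_cleanLU3_of_frame` (frame ⟹ `CleanLU3`) splits by the dimension of the local ring `S = A_{𝔪_O ∩ A}` of the regular affine
model `A` at the centre of the valuation ring `O`: this file does the case `dim S = 3`, where the FRAME hypothesis (the
registered consumer shape of INPUTS row F-CP15-frame: Cossart–Piltant 2019 Thm 1.5 (i) + Prop 2.22, base-side tower form)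
applies to `S` itself:

* `S` is excellent (a local ring of a finitely generated algebra over a field: `isExcellentRing_of_finiteType_field`,
  `IsExcellentRing.of_isLocalization`), regular of dimension `3`, of characteristic `p`, with fraction field `K`, dominated by
  `O`; the radicand is moved into `S`: `g₀ = a/b`, `f := a b^{p-1} = b^p g₀ ∈ A ⊆ S`, still not a `p`-th power;
* the frame returns a tower `S = B₀ ≤ ⋯ ≤ B_n ≤ O` of local blowing ups with radicands `g_i`, `g_{i+1} = c^p g_i + d^p`, and
  `B_n[X]/(X^p - g_n)` regular; by `exists_eq_locAtCentre_of_reflTransGen` (`LocalBlowup.lean`) `B_n` is the local ring at the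
  centre of `O` of a finitely generated model `A' = A[t] ⊆ O` (`PfaffLine.locAtCentre_closure_locAtCentre_union`, landed);
* `clean_shift_of_adjoinRoot_regular` (p657882) gives `c ∈ B_n` with `g_n - c^p` clean at `B_n`; along the tower
  `g_n = C^p f + D^p` (`C ≠ 0`), so `g_n - c^p = (C b)^p g₀ + (D - c)^p` is a NON-TRIVIAL representative of the `K^p`-line
  of `g₀`, loosely clean at `B_n = locAtCentre A' O` (parameter type ⟹ third loose disjunct with `c' = 0`; residually new
  unit ⟹ second).

The centres of dimension `≤ 2` (height-one points, generic points of curves on a threefold, the generic point) are NOT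
treated here (they need the dim-≤2 theory, not the frame).  Nothing here proves resolution in characteristic `p`.
-/

noncomputable section

set_option linter.dupNamespace false

open IsLocalRing Polynomial
open Literature.AlgebraicGeometry.Resolution

namespace Summit.ResolutionOfSingularities.ResolutionOfSingularities.Theorems.RadicialJung.CleanModels

/-! ## Bookkeeping lemmas -/

/-- Along a frame tower the radicand stays in the `K^p`-line of the initial one: if `g₀ = f` and
`g_{i+1} = c_i^p g_i + d_i^p` with `c_i ≠ 0` for `i < n`, then `g_n = C^p f + D^p` with `C ≠ 0`. [folklore] -/
theorem exists_line_of_tower {K : Type*} [Field K] (p : ℕ) [Fact p.Prime] [CharP K p] (f : K) (g : ℕ → K)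
    (h0 : g 0 = f) (n : ℕ) (hstep : ∀ i < n, ∃ c d : K, c ≠ 0 ∧ g (i + 1) = c ^ p * g i + d ^ p) :
    ∃ C D : K, C ≠ 0 ∧ g n = C ^ p * f + D ^ p := by
  induction n with
  | zero => exact ⟨1, 0, one_ne_zero, by rw [h0, one_pow, one_mul, zero_pow (Fact.out : p.Prime).ne_zero, add_zero]⟩
  | succ m ih =>
    obtain ⟨C, D, hC, hm⟩ := ih fun i hi => hstep i (Nat.lt_succ_of_lt hi)
    obtain ⟨c, d, hc, hs⟩ := hstep m (Nat.lt_succ_self m)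
    refine ⟨c * C, c * D + d, mul_ne_zero hc hC, ?_⟩
    rw [hs, hm, mul_pow, add_pow_char, mul_pow]
    ring

/-- A frame tower is a tower of local blowing ups: from the step data, `Relation.ReflTransGen (IsLocalBlowup O)` from
`B 0` to `B n`, and `B n` is its own localisation at the centre. [folklore] -/
theorem reflTransGen_of_steps {K : Type*} [Field K] (O : ValuationSubring K) (B : ℕ → Subring K) (n : ℕ)
    (h0 : locAtCentre (B 0) O = B 0)
    (hstep : ∀ i < n, ∃ P : Ideal (B i), IsLocalBlowupAlong O (B i) P (B (i + 1))) :
    Relation.ReflTransGen (IsLocalBlowup O) (B 0) (B n) ∧ locAtCentre (B n) O = B n := by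
  induction n with
  | zero => exact ⟨Relation.ReflTransGen.refl, h0⟩
  | succ m ih =>
    obtain ⟨hT, -⟩ := ih fun i hi => hstep i (Nat.lt_succ_of_lt hi)
    obtain ⟨P, hP⟩ := hstep m (Nat.lt_succ_self m)
    exact ⟨hT.tail hP.isLocalBlowup, hP.isLocalBlowup.locAtCentre_eq⟩

/-! ## The dimension-3 centre case of `stub_cleanLU3_of_frame` -/


/-- **Clean local uniformization at a 3-dimensional centre, from the frame.**  Hypotheses: the FRAME (the registered consumer
shape of Cossart–Piltant 2019 Thm 1.5 (i) + Prop 2.22, verbatim = `stub_cp2019Thm15iFrame` of `Cruxes/CleanModels/Lines/Sketch.lean`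
rev 12); a field `k` of characteristic `p`, a function field `K ⊇ k`, a valuation ring `O` of `K`, a finitely generated affine
model `A ⊆ O` of `K` (any dimension bound is irrelevant here) whose local ring `S = A_{𝔪_O ∩ A}` (realised in `K` as
`locAtCentre A O`) is regular OF DIMENSION 3, and `g₀ ∈ K ∖ K^p`.  Conclusion (= that of `CleanLU3`): a finitely generated
`A ⊆ A' ⊆ O` whose local ring at the centre is regular and at which a non-trivial representative `Σ_{j<p} c_j^p g₀^j` of the
`K^p`-line of `g₀` is loosely clean. [folklore] -/
theorem cleanLU_of_frame_of_dimThreeCentre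
    (hF : ∀ (p : ℕ), p.Prime →
      ∀ (S : Type) [CommRing S] [IsRegularLocalRing S],
        IsExcellentRing S → ringKrullDim S = 3 → CharP S p →
      ∀ (K : Type) [Field K] [Algebra S K] [IsFractionRing S K] (f : S),
        (∀ c : K, c ^ p ≠ algebraMap S K f) →
      ∀ (O : ValuationSubring K), (algebraMap S K).range ≤ O.toSubring →
        (∀ s ∈ IsLocalRing.maximalIdeal S, O.valuation (algebraMap S K s) < 1) →
      ∃ (n : ℕ) (B : ℕ → Subring K) (g : ℕ → K),
        B 0 = locAtCentre (algebraMap S K).range O ∧ g 0 = algebraMap S K f ∧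
        (∀ i ≤ n, B i ≤ O.toSubring ∧ IsRegularLocalRing (B i) ∧ g i ∈ B i) ∧
        (∀ i < n, ∃ P : Ideal (B i), IsRegularLocalRing ((B i) ⧸ P) ∧
          IsLocalBlowupAlong O (B i) P (B (i + 1)) ∧
          ∃ c d : K, c ≠ 0 ∧ g (i + 1) = c ^ p * g i + d ^ p) ∧
        ∀ hg : g n ∈ B n, IsRegularLocalRing (AdjoinRoot (Polynomial.X ^ p - Polynomial.C (⟨g n, hg⟩ : B n))))
    (p : ℕ) (hp : p.Prime) (k : Type) [Field k] [CharP k p] (K : Type) [Field K] [Algebra k K]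
    (O : ValuationSubring K) (A : Subalgebra k K) (hAO : A.toSubring ≤ O.toSubring) (hAfg : A.FG)
    (hfrac : IsFractionRing A K)
    (hreg : IsRegularLocalRing (locAtCentre A.toSubring O))
    (hdim3 : ringKrullDim (locAtCentre A.toSubring O) = 3)
    (g₀ : K) (hg₀ : ∀ c : K, c ^ p ≠ g₀) :
    ∃ (A' : Subalgebra k K), A'.toSubring ≤ O.toSubring ∧ A ≤ A' ∧ A'.FG ∧
      ∃ (_ : IsRegularLocalRing (locAtCentre A'.toSubring O)) (c : Fin p → K),
        (∃ j : Fin p, (j : ℕ) ≠ 0 ∧ c j ≠ 0) ∧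
        ((∃ (d m : ℕ) (hmd : m ≤ d) (t : Fin d → ↥(locAtCentre A'.toSubring O)) (a : Fin m → ℕ)
            (u : ↥(locAtCentre A'.toSubring O)), IsUnit u ∧
            Ideal.span (Set.range t) = IsLocalRing.maximalIdeal ↥(locAtCentre A'.toSubring O) ∧
            ringKrullDim ↥(locAtCentre A'.toSubring O) = (d : WithBot ℕ∞) ∧ 0 < m ∧ (∀ i, ¬ p ∣ a i) ∧
            (∑ j : Fin p, c j ^ p * g₀ ^ (j : ℕ)) =
              (u : K) * ∏ i : Fin m, ((t (Fin.castLE hmd i) : ↥(locAtCentre A'.toSubring O)) : K) ^ (a i)) ∨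
          (∃ u : ↥(locAtCentre A'.toSubring O), IsUnit u ∧ (∑ j : Fin p, c j ^ p * g₀ ^ (j : ℕ)) = (u : K) ∧
            ∀ c' : ↥(locAtCentre A'.toSubring O), u - c' ^ p ∉ IsLocalRing.maximalIdeal ↥(locAtCentre A'.toSubring O)) ∨
          (∃ s c' : ↥(locAtCentre A'.toSubring O), (∑ j : Fin p, c j ^ p * g₀ ^ (j : ℕ)) = (s : K) ∧
            s - c' ^ p ∈ IsLocalRing.maximalIdeal ↥(locAtCentre A'.toSubring O) ∧
            s - c' ^ p ∉ IsLocalRing.maximalIdeal ↥(locAtCentre A'.toSubring O) ^ 2)) := by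
  classical
  haveI : Fact p.Prime := ⟨hp⟩
  haveI := hreg
  set S : Subring K := locAtCentre A.toSubring O with hSdef
  have hSO : S ≤ O.toSubring := locAtCentre_le hAO
  have hAS : A.toSubring ≤ S := le_locAtCentre A.toSubring O
  -- characteristic
  haveI : CharP K p := charP_of_injective_algebraMap (algebraMap k K).injective p
  haveI hSp : CharP S p := (S.subtype).charP Subtype.val_injective p
  -- `S` is excellent: a localisation of the finitely generated `k`-algebra `A`
  haveI : Algebra.FiniteType k A := (Subalgebra.fg_iff_finiteType A).mp hAfg
  have hexcA : IsExcellentRing A := isExcellentRing_of_finiteType_field k A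
  haveI := isLocalization_locAtCentre (K := K) (O := O) hAO
  have hexcS : IsExcellentRing S :=
    IsExcellentRing.of_isLocalization (A := A.toSubring) (B := S) (subringCentre A.toSubring O hAO).primeCompl hexcA
  -- `K = Frac S`
  haveI : IsFractionRing S K := by
    refine IsFractionRing.of_field S K fun z => ?_
    obtain ⟨a, b, -, hab⟩ := IsFractionRing.div_surjective (A := A) z
    exact ⟨⟨a, hAS a.2⟩, ⟨b, hAS b.2⟩, hab.symm⟩
  -- the radicand moved into `A ⊆ S`: `g₀ = a / b`, `f = a b^{p-1} = b^p g₀`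
  obtain ⟨a, b, hb, hab⟩ := IsFractionRing.div_surjective (A := A) g₀
  have hb0 : (b : K) ≠ 0 := by
    intro h
    have : (b : A) = 0 := Subtype.ext h
    exact (nonZeroDivisors.ne_zero hb) this
  have hab' : g₀ = (a : K) / (b : K) := hab.symm
  set f : S := ⟨(a : K) * (b : K) ^ (p - 1), S.mul_mem (hAS a.2) (S.pow_mem (hAS b.2) _)⟩ with hfdef
  have hfK : ((f : S) : K) = (b : K) ^ p * g₀ := by
    rw [hfdef, hab']
    have : (b : K) ^ p = (b : K) ^ (p - 1) * b := by
      rw [← pow_succ, Nat.sub_add_cancel hp.one_lt.le]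
    rw [this]
    field_simp
  have hfp : ∀ c : K, c ^ p ≠ algebraMap S K f := by
    intro c hc
    apply hg₀ (c / b)
    rw [div_pow, hc]
    change ((f : S) : K) / (b : K) ^ p = g₀
    rw [hfK]
    field_simp
  -- domination
  have hrange : (algebraMap S K).range ≤ O.toSubring := by
    rintro _ ⟨s, rfl⟩
    exact hSO s.2
  have hdom : ∀ s ∈ IsLocalRing.maximalIdeal S, O.valuation (algebraMap S K s) < 1 := by
    intro s hs
    exact (mem_maximalIdeal_locAtCentre_iff hAO s).mp hs
  -- THE FRAME
  obtain ⟨n, B, g, hB0, hg0, hBall, hstep, hend⟩ := hF p hp S hexcS hdim3 hSp K f hfp O hrange hdom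
  have hrangeS : (algebraMap S K).range = S := by
    ext x
    constructor
    · rintro ⟨s, rfl⟩; exact s.2
    · intro hx; exact ⟨⟨x, hx⟩, rfl⟩
  have hB0' : B 0 = S := by rw [hB0, hrangeS, hSdef, locAtCentre_locAtCentre]
  -- the tower is a tower of local blowing ups; `B n` is a local ring at the centre of a finitely generated model
  obtain ⟨hT, hBnloc⟩ := reflTransGen_of_steps O B n (by rw [hB0', hSdef, locAtCentre_locAtCentre])
    (fun i hi => by obtain ⟨P, -, hP, -⟩ := hstep i hi; exact ⟨P, hP⟩)
  obtain ⟨-, t, htO, hBn⟩ := exists_eq_locAtCentre_of_reflTransGen (by rw [hB0']; exact hSO) hT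
  rw [hBnloc, hB0', hSdef, PfaffLine.locAtCentre_closure_locAtCentre_union] at hBn
  -- hBn : B n = locAtCentre (Subring.closure (↑A.toSubring ∪ ↑t)) O
  -- the finitely generated model `A' = A[t]`
  let A' : Subalgebra k K :=
    { Subring.closure ((A.toSubring : Set K) ∪ ↑t) with
      algebraMap_mem' := fun r => Subring.subset_closure (Or.inl (A.algebraMap_mem r)) }
  have hA'sub : A'.toSubring = Subring.closure ((A.toSubring : Set K) ∪ ↑t) := rfl
  have hAA' : A ≤ A' := fun x hx => Subring.subset_closure (Or.inl hx)
  have hA'O : A'.toSubring ≤ O.toSubring := by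
    rw [hA'sub, Subring.closure_le]
    rintro x (hx | hx)
    · exact hAO hx
    · exact htO hx
  have hA'fg : A'.FG := by
    obtain ⟨s₀, hs₀⟩ := hAfg
    refine ⟨s₀ ∪ t, le_antisymm ?_ ?_⟩
    · rw [Algebra.adjoin_le_iff]
      rintro x hx
      rw [Finset.coe_union] at hx
      rcases hx with hx | hx
      · exact hAA' (hs₀ ▸ Algebra.subset_adjoin hx)
      · exact Subring.subset_closure (Or.inr hx)
    · intro x hx
      change x ∈ Subring.closure ((A.toSubring : Set K) ∪ ↑t) at hx
      have hle : Subring.closure ((A.toSubring : Set K) ∪ ↑t) ≤ (Algebra.adjoin k (↑(s₀ ∪ t) : Set K)).toSubring := by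
        rw [Subring.closure_le]
        rintro y (hy | hy)
        · have : y ∈ Algebra.adjoin k (s₀ : Set K) := by rw [hs₀]; exact hy
          exact Algebra.adjoin_mono (by rw [Finset.coe_union]; exact Set.subset_union_left) this
        · exact Algebra.subset_adjoin (by rw [Finset.coe_union]; exact Or.inr hy)
      exact hle hx
  have hBnA' : B n = locAtCentre A'.toSubring O := by rw [hA'sub]; exact hBn
  -- facts about `B n`
  obtain ⟨hBnO, hBnreg, hgn⟩ := hBall n le_rfl
  haveI := hBnreg
  haveI : CharP (B n) p := ((B n).subtype).charP Subtype.val_injective p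
  have hcover := hend hgn
  -- cleanness of a shift of `g n` at `B n`
  obtain ⟨c, hclean⟩ := clean_shift_of_adjoinRoot_regular (S := B n) p hp ⟨g n, hgn⟩ hcover
  -- `g n` in the `K^p`-line of `f`, hence of `g₀`
  obtain ⟨C, D, hC, hline⟩ := exists_line_of_tower p (algebraMap S K f) g hg0 n
    (fun i hi => by obtain ⟨-, -, -, hcd⟩ := hstep i hi; exact hcd)
  -- the representative `(D - c)^p + (C b)^p g₀ = g n - c^p`
  have htwo : 2 ≤ p := hp.two_le
  let j0 : Fin p := ⟨0, hp.pos⟩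
  let j1 : Fin p := ⟨1, hp.one_lt⟩
  let cvec : Fin p → K := fun j => if j = j1 then C * (b : K) else if j = j0 then D - (c : K) else 0
  have hj01 : j0 ≠ j1 := by
    intro h; have := congrArg Fin.val h; simp [j0, j1] at this
  have hsum : (∑ j : Fin p, cvec j ^ p * g₀ ^ (j : ℕ)) = g n - (c : K) ^ p := by
    rw [Finset.sum_eq_add j0 j1 hj01]
    · have hfK' : (algebraMap S K) f = (b : K) ^ p * g₀ := hfK
      simp only [cvec, j0, j1, if_neg hj01, if_pos rfl, if_true, pow_zero, mul_one, pow_one]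
      rw [hline, hfK', mul_pow, sub_pow_char]
      ring
    · intro j _ hj
      simp only [cvec, if_neg hj.2, if_neg hj.1, zero_pow hp.ne_zero, zero_mul]
    · intro h; exact absurd (Finset.mem_univ _) h
    · intro h; exact absurd (Finset.mem_univ _) h
  -- assemble
  refine ⟨A', hA'O, hAA', hA'fg, ?_⟩
  rw [← hBnA']
  refine ⟨hBnreg, cvec, ⟨j1, by simp [j1], by simp [cvec, j1, hC, hb0]⟩, ?_⟩
  rcases hclean with ⟨hm, hm2⟩ | ⟨hu, hres⟩
  · -- parameter type: third loose disjunct with `c' = 0`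
    refine Or.inr (Or.inr ⟨⟨g n, hgn⟩ - c ^ p, 0, ?_, ?_, ?_⟩)
    · rw [hsum]; rfl
    · rw [zero_pow hp.ne_zero, sub_zero]; exact hm
    · rw [zero_pow hp.ne_zero, sub_zero]; exact hm2
  · -- residually new unit: second loose disjunct
    refine Or.inr (Or.inl ⟨⟨g n, hgn⟩ - c ^ p, hu, ?_, hres⟩)
    rw [hsum]; rfl

end Summit.ResolutionOfSingularities.ResolutionOfSingularities.Theorems.RadicialJung.CleanModels

end
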